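import Summits.ValiantsHypothesis.ValiantsHypothesis.Theorems.GeneratorObstructionsPerGenDegreeSuperQPFaceLayers

/-!
# Route GeneratorObstructions — K1 `PerGenDegreeSuperQP` (stmt-ValiantsHypothesis-11654),
# line `per-side-atoms`: MINIMAL-JUMP atoms of the two-block faces
# (first fattening of the least rectangular part; `stub_atomLate` ⇐ a late first fattening)

Companion of `…FaceLayers` (face layers of the occurrence monoid start with an atom).

Fix a cut `p` of the linearly ordered index type. An occurring weight of `ℂ[Δ_n[f]]` that is
constant on `{a ≤ p}` and on `{a > p}` ("two-block at `p`") has the shape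
`-(t·𝟙 + k·𝟙_{a > p})` with FATTENING `t ≥ 0` and JUMP `k ≥ 0` (dominance); `k = 0` are the
constant weights. The two-block weights at `p` form a two-dimensional face of `S(f)`, and
`…FaceLayers.per_exists_atom_of_fatLayer` showed that its least-DEGREE non-constant point is an
atom. This file extracts the atoms organised by jump:

1. `exists_atom_of_indecomposableJump` — if some non-constant occurring weight has jump `k` at
   `p`, and `k` is JUMP-INDECOMPOSABLE (no two non-constant occurring weights sum to a weight of
   jump `k` at `p`), then the least-degree occurring weight of jump `k` — i.e. the one with the
   least fattening `t` — is an ATOM of `S(f)`. (Instance of `exists_atom_of_layer` with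
   `P` = two-block at `p` and `R` = "jump `k` ⇒ constant", which is additive exactly when `k` is
   jump-indecomposable.)
2. `exists_atom_minJump` — the MINIMAL positive jump `k_min(p)` occurring at `p` is
   jump-indecomposable (occurring non-constant two-block weights have jump `≥ k_min`, so two of
   them give jump `≥ 2 k_min`); hence **the first fattening of the minimal jump is an atom**:
   the occurring weight `-(t·𝟙 + k_min·𝟙_{a > p})` with `t` least.
3. `stub_atomLate_of_late_minJump` — the registered `stub_atomLate` VERBATIM from: for every `c`
   and infinitely many `m` there is a cut `p` of `MatIdx m` whose two-block face is populated
   and every occurring weight of MINIMAL jump at `p` has degree `> 2^((log₂ m + c)^c)` — i.e.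
   the first fattening `t` of the minimal jump is late (degree `= t·m + k_min·#{a > p}/m`).

Why this is the right currency (informal; NOT used in the proofs, see the module docstring of
`…FaceLayers` and this session's evidence memo): restriction to the closed `SL_{m²}`-orbit of
`per_m` identifies the jumps occurring at the cut `p`, `j = #{a ≤ p}`, with
`{k : V_{k ω_j}(SL_{m²})^{H'} ≠ 0}`, `H' = Stab_{SL}(per_m)`; so `k_min(p) = k_j(m) ≤ 2m²` for
EVERY cut (translated Plücker monomials, squared and symmetrised), every two-block face is
populated, and the atom of item 2 has degree `t_j(m)·m + k_j(m)(m² - j)/m` with polynomial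
second term. Lateness of this atom is therefore EXACTLY lateness of the first fattening
`t_j(m)` — the least `t` for which the orbit type `k_j(m)·ω_j` first occurs in degree
`t·m + k_j(m)(m²-j)/m` of the coordinate ring of the orbit CLOSURE (Bürgisser–Ikenmeyer 2017,
Prop. 3.9: `ℂ[GL·per_m] = ℂ[Δ(per_m)]_{Φ}`, so `t_j(m) < ∞`). No bound on `t_j(m)` in either
direction is in print.

Honest framing: structure lemmas and a conditional reduction; `stub_atomLate` (for `c ≥ 2`), K1
and `GenFlipThesis` remain OPEN; nothing here bears on VP versus VNP.
References: [BurgisserIkenmeyer2017] Prop. 3.9 (orbit versus closure);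
[BurgisserHuttenhainIkenmeyer2017] §2 as background only.
-/

set_option linter.dupNamespace false

noncomputable section

namespace Summit.ValiantsHypothesis.ValiantsHypothesis.Theorems.GeneratorObstructions.PerGenDegreeSuperQP

open MvPolynomial
open Literature.NumberTheory.DiophantineGeometry Literature.Computability.AlgebraicComplexity
  Literature.Computability.Complexity

/-! ### 1. Jumps of two-block weights -/

section Jump

variable {σ : Type*} [Fintype σ] [LinearOrder σ]

omit [Fintype σ] in
/-- A weight with jump `k` at the cut `p` (`χ a = χ b + k` for `a ≤ p < b`) is two-block at `p`
(constant on `{a ≤ p}` and on `{a > p}`) as soon as both blocks are nonempty; we record the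
version used below: if some index lies above `p`, a weight of jump `k` is constant on
`{a ≤ p}`, and if some index lies at or below `p` it is constant on `{a > p}`. [folklore] -/
theorem isTwoBlock_of_jump (p : σ) {k : ℤ} {χ : Weight σ}
    (hk : ∀ a b : σ, a ≤ p → ¬ b ≤ p → χ a = χ b + k)
    (hlo : ∃ a₀ : σ, a₀ ≤ p) (hhi : ∃ b₀ : σ, ¬ b₀ ≤ p) :
    ∀ a b : σ, (a ≤ p ↔ b ≤ p) → χ a = χ b := by
  obtain ⟨a₀, ha₀⟩ := hlo
  obtain ⟨b₀, hb₀⟩ := hhi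
  intro a b hab
  by_cases ha : a ≤ p
  · have hb : b ≤ p := hab.mp ha
    rw [hk a b₀ ha hb₀, hk b b₀ hb hb₀]
  · have hb : ¬ b ≤ p := fun h => ha (hab.mpr h)
    have h1 := hk a₀ a ha₀ ha
    have h2 := hk a₀ b ha₀ hb
    omega

/-- A two-block weight at `p` has SOME jump `k : ℤ` at `p`. [folklore] -/
theorem exists_jump_of_isTwoBlock (p : σ) {χ : Weight σ}
    (h2 : ∀ a b : σ, (a ≤ p ↔ b ≤ p) → χ a = χ b) :
    ∃ k : ℤ, ∀ a b : σ, a ≤ p → ¬ b ≤ p → χ a = χ b + k := by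
  by_cases hhi : ∃ b₀ : σ, ¬ b₀ ≤ p
  · obtain ⟨b₀, hb₀⟩ := hhi
    by_cases hlo : ∃ a₀ : σ, a₀ ≤ p
    · obtain ⟨a₀, ha₀⟩ := hlo
      refine ⟨χ a₀ - χ b₀, fun a b ha hb => ?_⟩
      rw [h2 a a₀ (iff_of_true ha ha₀), h2 b b₀ (iff_of_false hb hb₀)]
      ring
    · exact ⟨0, fun a _ ha _ => absurd ⟨a, ha⟩ hlo⟩
  · exact ⟨0, fun _ b _ hb => absurd ⟨b, hb⟩ hhi⟩

/-- The jump of an OCCURRING weight of `ℂ[Δ_n[f]]` at any cut is nonnegative (occurring weights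
are dominant). [folklore] -/
theorem jump_nonneg_of_occurs (f : MvPolynomial σ ℂ) (n : ℕ) (p : σ) {k : ℤ} {χ : Weight σ}
    (hχ : highestWeightSpace (orbitCoordRep f n) χ ≠ ⊥)
    (hk : ∀ a b : σ, a ≤ p → ¬ b ≤ p → χ a = χ b + k)
    (hlo : ∃ a₀ : σ, a₀ ≤ p) (hhi : ∃ b₀ : σ, ¬ b₀ ≤ p) : 0 ≤ k := by
  haveI : Infinite ℂ := CharZero.infinite ℂ
  obtain ⟨a₀, ha₀⟩ := hlo
  obtain ⟨b₀, hb₀⟩ := hhi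
  have hdom := isDominant_of_hasHighestWeight_orbitCoordRep f
    (show HasHighestWeight (orbitCoordRep f n) χ from hχ)
  have hle : χ b₀ ≤ χ a₀ := hdom (le_of_lt (lt_of_le_of_lt ha₀ (not_le.mp hb₀)))
  have := hk a₀ b₀ ha₀ hb₀
  omega

omit [Fintype σ] in
/-- A two-block weight of jump `0` is constant. [folklore] -/
theorem isConstant_of_jump_zero (p : σ) {χ : Weight σ}
    (hk : ∀ a b : σ, a ≤ p → ¬ b ≤ p → χ a = χ b + 0)
    (h2 : ∀ a b : σ, (a ≤ p ↔ b ≤ p) → χ a = χ b) : ∀ a b : σ, χ a = χ b := by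
  intro a b
  by_cases ha : a ≤ p
  · by_cases hb : b ≤ p
    · exact h2 a b (iff_of_true ha hb)
    · simpa using hk a b ha hb
  · by_cases hb : b ≤ p
    · simpa using (hk b a hb ha).symm
    · exact h2 a b (iff_of_false ha hb)

/-- **The jump of a NON-constant occurring two-block weight is positive.** [folklore] -/
theorem jump_pos_of_occurs_of_not_isConstant (f : MvPolynomial σ ℂ) (n : ℕ) (p : σ) {k : ℤ}
    {χ : Weight σ} (hχ : highestWeightSpace (orbitCoordRep f n) χ ≠ ⊥)
    (h2 : ∀ a b : σ, (a ≤ p ↔ b ≤ p) → χ a = χ b)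
    (hk : ∀ a b : σ, a ≤ p → ¬ b ≤ p → χ a = χ b + k)
    (hnc : ¬ ∀ a b : σ, χ a = χ b) : 0 < k := by
  -- both blocks are nonempty, else `χ` would be constant
  have hlo : ∃ a₀ : σ, a₀ ≤ p := ⟨p, le_rfl⟩
  have hhi : ∃ b₀ : σ, ¬ b₀ ≤ p := by
    by_contra h
    push Not at h
    exact hnc fun a b => h2 a b (iff_of_true (h a) (h b))
  have h0 := jump_nonneg_of_occurs f n p hχ hk hlo hhi
  rcases h0.lt_or_eq with hpos | hzero
  · exact hpos
  · exact absurd (isConstant_of_jump_zero p (by rw [hzero]; exact hk) h2) hnc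

omit [Fintype σ] in
/-- Jumps add: if `χ` has jump `k₁` and `ψ` has jump `k₂` at `p` then `χ + ψ` has jump
`k₁ + k₂`. [folklore] -/
theorem jump_add (p : σ) {k₁ k₂ : ℤ} {χ ψ : Weight σ}
    (h1 : ∀ a b : σ, a ≤ p → ¬ b ≤ p → χ a = χ b + k₁)
    (h2 : ∀ a b : σ, a ≤ p → ¬ b ≤ p → ψ a = ψ b + k₂) :
    ∀ a b : σ, a ≤ p → ¬ b ≤ p → (χ + ψ) a = (χ + ψ) b + (k₁ + k₂) := by
  intro a b ha hb
  simp only [Pi.add_apply, h1 a b ha hb, h2 a b ha hb]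
  ring

omit [Fintype σ] in
/-- Jumps are determined: two jumps of one weight at a cut with both blocks nonempty agree.
[folklore] -/
theorem jump_unique (p : σ) {k k' : ℤ} {χ : Weight σ}
    (h1 : ∀ a b : σ, a ≤ p → ¬ b ≤ p → χ a = χ b + k)
    (h2 : ∀ a b : σ, a ≤ p → ¬ b ≤ p → χ a = χ b + k')
    (hlo : ∃ a₀ : σ, a₀ ≤ p) (hhi : ∃ b₀ : σ, ¬ b₀ ≤ p) : k = k' := by
  obtain ⟨a₀, ha₀⟩ := hlo
  obtain ⟨b₀, hb₀⟩ := hhi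
  have := h1 a₀ b₀ ha₀ hb₀
  have := h2 a₀ b₀ ha₀ hb₀
  omega

end Jump

/-! ### 2. Indecomposable jumps give atoms -/

section Atoms

variable {σ : Type*} [Fintype σ] [LinearOrder σ]

/-- A non-constant two-block weight has a nonempty upper block. [folklore] -/
theorem exists_not_le_of_isTwoBlock_of_not_isConstant (p : σ) {χ : Weight σ}
    (h2 : ∀ a b : σ, (a ≤ p ↔ b ≤ p) → χ a = χ b) (hnc : ¬ ∀ a b : σ, χ a = χ b) :
    ∃ b₀ : σ, ¬ b₀ ≤ p := by
  by_contra h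
  push Not at h
  exact hnc fun a b => h2 a b (iff_of_true (h a) (h b))

omit [Fintype σ] in
/-- A constant weight has jump `0` at every cut. [folklore] -/
theorem jump_zero_of_isConstant (p : σ) {χ : Weight σ} (hc : ∀ a b : σ, χ a = χ b) :
    ∀ a b : σ, a ≤ p → ¬ b ≤ p → χ a = χ b + 0 := by
  intro a b _ _
  rw [add_zero]
  exact hc a b

/-- **An indecomposable jump starts with an atom.** Fix a cut `p` and `k : ℤ`. Suppose some
NON-constant two-block weight occurring in `ℂ[Δ_n[f]]` has jump `k` at `p`, and `k` is
JUMP-INDECOMPOSABLE at `p`: no two non-constant occurring weights sum to a weight of jump `k` at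
`p`. Then the least-degree occurring non-constant two-block weight of jump `k` at `p` — the one
with the least fattening — exists and is an ATOM of the occurrence monoid. (Layer `P ∧ ¬R` of
`…FaceLayers.exists_atom_of_layer` with `P` = two-block at `p`, facial, and `R` = "jump `k` ⇒
constant", additive on the face by indecomposability and uniqueness of jumps.) [folklore] -/
theorem exists_atom_of_indecomposableJump (f : MvPolynomial σ ℂ) (n : ℕ) (p : σ) (k : ℤ)
    (hex : ∃ χ : Weight σ, highestWeightSpace (orbitCoordRep f n) χ ≠ ⊥ ∧
      (∀ a b : σ, (a ≤ p ↔ b ≤ p) → χ a = χ b) ∧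
      (∀ a b : σ, a ≤ p → ¬ b ≤ p → χ a = χ b + k) ∧ ¬ (∀ a b : σ, χ a = χ b))
    (hind : ∀ ψ₁ ψ₂ : Weight σ, highestWeightSpace (orbitCoordRep f n) ψ₁ ≠ ⊥ →
      highestWeightSpace (orbitCoordRep f n) ψ₂ ≠ ⊥ → ¬ (∀ a b : σ, ψ₁ a = ψ₁ b) →
      ¬ (∀ a b : σ, ψ₂ a = ψ₂ b) →
      ¬ (∀ a b : σ, a ≤ p → ¬ b ≤ p → (ψ₁ + ψ₂) a = (ψ₁ + ψ₂) b + k)) :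
    ∃ χ : Weight σ, highestWeightSpace (orbitCoordRep f n) χ ≠ ⊥ ∧
      (∀ a b : σ, (a ≤ p ↔ b ≤ p) → χ a = χ b) ∧
      (∀ a b : σ, a ≤ p → ¬ b ≤ p → χ a = χ b + k) ∧ ¬ (∀ a b : σ, χ a = χ b) ∧
      (∀ ψ : Weight σ, highestWeightSpace (orbitCoordRep f n) ψ ≠ ⊥ →
        (∀ a b : σ, (a ≤ p ↔ b ≤ p) → ψ a = ψ b) →
        (∀ a b : σ, a ≤ p → ¬ b ≤ p → ψ a = ψ b + k) → ¬ (∀ a b : σ, ψ a = ψ b) →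
          ψ.size ≤ χ.size) ∧
      (∀ χ₁ χ₂ : Weight σ, χ₁ + χ₂ = χ → χ₁ ≠ 0 → χ₂ ≠ 0 →
        highestWeightSpace (orbitCoordRep f n) χ₁ = ⊥ ∨
          highestWeightSpace (orbitCoordRep f n) χ₂ = ⊥) := by
  classical
  -- the layer: `P` = two-block at `p`, `R` = (jump `k` → constant)
  let P : Weight σ → Prop := fun χ => ∀ a b : σ, (a ≤ p ↔ b ≤ p) → χ a = χ b
  let R : Weight σ → Prop := fun χ =>
    (∀ a b : σ, a ≤ p → ¬ b ≤ p → χ a = χ b + k) → ∀ a b : σ, χ a = χ b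
  have hface : ∀ χ₁ χ₂ : Weight σ, highestWeightSpace (orbitCoordRep f n) χ₁ ≠ ⊥ →
      highestWeightSpace (orbitCoordRep f n) χ₂ ≠ ⊥ → P (χ₁ + χ₂) → P χ₁ ∧ P χ₂ := by
    intro χ₁ χ₂ h1 h2 h
    have key := isBlockConstant_face f n (fun a : σ => decide (a ≤ p)) χ₁ χ₂ h1 h2
    simp only [decide_eq_decide] at key
    exact key h
  have hadd : ∀ χ₁ χ₂ : Weight σ, highestWeightSpace (orbitCoordRep f n) χ₁ ≠ ⊥ →
      highestWeightSpace (orbitCoordRep f n) χ₂ ≠ ⊥ → P χ₁ → P χ₂ → R χ₁ → R χ₂ → R (χ₁ + χ₂) := by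
    intro χ₁ χ₂ h1 h2 hP1 hP2 hR1 hR2 hk12
    by_cases hc1 : ∀ a b : σ, χ₁ a = χ₁ b
    · by_cases hc2 : ∀ a b : σ, χ₂ a = χ₂ b
      · exact isConstant_add hc1 hc2
      · -- `χ₂` has some jump `k₂`; the sum has jump `0 + k₂ = k`, so `k₂ = k` and `R χ₂` bites
        exfalso
        obtain ⟨k₂, hk₂⟩ := exists_jump_of_isTwoBlock p hP2
        have hsum := jump_add p (jump_zero_of_isConstant p hc1) hk₂
        have hhi := exists_not_le_of_isTwoBlock_of_not_isConstant p hP2 hc2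
        have hkk : 0 + k₂ = k := jump_unique p hsum hk12 ⟨p, le_rfl⟩ hhi
        rw [zero_add] at hkk
        rw [hkk] at hk₂
        exact hc2 (hR2 hk₂)
    · by_cases hc2 : ∀ a b : σ, χ₂ a = χ₂ b
      · exfalso
        obtain ⟨k₁, hk₁⟩ := exists_jump_of_isTwoBlock p hP1
        have hsum := jump_add p hk₁ (jump_zero_of_isConstant p hc2)
        have hhi := exists_not_le_of_isTwoBlock_of_not_isConstant p hP1 hc1
        have hkk : k₁ + 0 = k := jump_unique p hsum hk12 ⟨p, le_rfl⟩ hhi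
        rw [add_zero] at hkk
        rw [hkk] at hk₁
        exact hc1 (hR1 hk₁)
      · exact absurd hk12 (hind χ₁ χ₂ h1 h2 hc1 hc2)
  have hex' : ∃ χ : Weight σ, highestWeightSpace (orbitCoordRep f n) χ ≠ ⊥ ∧ P χ ∧ ¬ R χ := by
    obtain ⟨χ, hχ, hP, hk, hnc⟩ := hex
    exact ⟨χ, hχ, hP, fun hR => hnc (hR hk)⟩
  obtain ⟨χ, hχ, hP, hnR, hmin, hatom⟩ := exists_atom_of_layer f n P R hface hadd hex'
  have hk : ∀ a b : σ, a ≤ p → ¬ b ≤ p → χ a = χ b + k := by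
    by_contra h
    exact hnR fun h' => absurd h' h
  have hnc : ¬ ∀ a b : σ, χ a = χ b := fun hc => hnR fun _ => hc
  refine ⟨χ, hχ, hP, hk, hnc, ?_, hatom⟩
  intro ψ hψ hPψ hkψ hncψ
  exact hmin ψ hψ hPψ fun hR => hncψ (hR hkψ)

/-- **The minimal jump starts with an atom.** Fix a cut `p`. If some NON-constant two-block
weight occurs in `ℂ[Δ_n[f]]` at `p`, let `k` be the LEAST positive jump of such weights. Then
`k` is jump-indecomposable (two non-constant occurring weights summing to a two-block weight are
two-block with jumps `≥ k`, so the sum has jump `≥ 2k > k`), and the least-degree occurring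
weight of jump `k` — the FIRST FATTENING OF THE MINIMAL JUMP — is an ATOM of the occurrence
monoid. [folklore] -/
theorem exists_atom_minJump (f : MvPolynomial σ ℂ) (n : ℕ) (p : σ)
    (hex : ∃ χ : Weight σ, highestWeightSpace (orbitCoordRep f n) χ ≠ ⊥ ∧
      (∀ a b : σ, (a ≤ p ↔ b ≤ p) → χ a = χ b) ∧ ¬ (∀ a b : σ, χ a = χ b)) :
    ∃ k : ℤ, 0 < k ∧
      (∀ ψ : Weight σ, highestWeightSpace (orbitCoordRep f n) ψ ≠ ⊥ →
        (∀ a b : σ, (a ≤ p ↔ b ≤ p) → ψ a = ψ b) → ¬ (∀ a b : σ, ψ a = ψ b) →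
        ∀ k' : ℤ, (∀ a b : σ, a ≤ p → ¬ b ≤ p → ψ a = ψ b + k') → k ≤ k') ∧
      ∃ χ : Weight σ, highestWeightSpace (orbitCoordRep f n) χ ≠ ⊥ ∧
        (∀ a b : σ, (a ≤ p ↔ b ≤ p) → χ a = χ b) ∧
        (∀ a b : σ, a ≤ p → ¬ b ≤ p → χ a = χ b + k) ∧ ¬ (∀ a b : σ, χ a = χ b) ∧
        (∀ ψ : Weight σ, highestWeightSpace (orbitCoordRep f n) ψ ≠ ⊥ →
          (∀ a b : σ, (a ≤ p ↔ b ≤ p) → ψ a = ψ b) →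
          (∀ a b : σ, a ≤ p → ¬ b ≤ p → ψ a = ψ b + k) → ¬ (∀ a b : σ, ψ a = ψ b) →
            ψ.size ≤ χ.size) ∧
        (∀ χ₁ χ₂ : Weight σ, χ₁ + χ₂ = χ → χ₁ ≠ 0 → χ₂ ≠ 0 →
          highestWeightSpace (orbitCoordRep f n) χ₁ = ⊥ ∨
            highestWeightSpace (orbitCoordRep f n) χ₂ = ⊥) := by
  classical
  -- positive jumps of occurring non-constant two-block weights, as natural numbers
  have hexN : ∃ K : ℕ, ∃ χ : Weight σ, highestWeightSpace (orbitCoordRep f n) χ ≠ ⊥ ∧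
      (∀ a b : σ, (a ≤ p ↔ b ≤ p) → χ a = χ b) ∧ ¬ (∀ a b : σ, χ a = χ b) ∧
      (∀ a b : σ, a ≤ p → ¬ b ≤ p → χ a = χ b + (K : ℤ)) := by
    obtain ⟨χ, hχ, h2, hnc⟩ := hex
    obtain ⟨k, hk⟩ := exists_jump_of_isTwoBlock p h2
    have hpos := jump_pos_of_occurs_of_not_isConstant f n p hχ h2 hk hnc
    refine ⟨k.toNat, χ, hχ, h2, hnc, ?_⟩
    rw [Int.toNat_of_nonneg hpos.le]
    exact hk
  set K := Nat.find hexN with hK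
  obtain ⟨χ₀, hχ₀, h2₀, hnc₀, hk₀⟩ := Nat.find_spec hexN
  have hKpos : (0 : ℤ) < (K : ℤ) := jump_pos_of_occurs_of_not_isConstant f n p hχ₀ h2₀ hk₀ hnc₀
  -- minimality of `K` among all jumps of occurring non-constant two-block weights
  have hKmin : ∀ ψ : Weight σ, highestWeightSpace (orbitCoordRep f n) ψ ≠ ⊥ →
      (∀ a b : σ, (a ≤ p ↔ b ≤ p) → ψ a = ψ b) → ¬ (∀ a b : σ, ψ a = ψ b) →
      ∀ k' : ℤ, (∀ a b : σ, a ≤ p → ¬ b ≤ p → ψ a = ψ b + k') → (K : ℤ) ≤ k' := by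
    intro ψ hψ h2ψ hncψ k' hk'
    have hpos := jump_pos_of_occurs_of_not_isConstant f n p hψ h2ψ hk' hncψ
    have hle : K ≤ k'.toNat := by
      apply Nat.find_min' hexN
      refine ⟨ψ, hψ, h2ψ, hncψ, ?_⟩
      rw [Int.toNat_of_nonneg hpos.le]
      exact hk'
    have : ((k'.toNat : ℕ) : ℤ) = k' := Int.toNat_of_nonneg hpos.le
    omega
  -- indecomposability of the minimal jump
  have hind : ∀ ψ₁ ψ₂ : Weight σ, highestWeightSpace (orbitCoordRep f n) ψ₁ ≠ ⊥ →
      highestWeightSpace (orbitCoordRep f n) ψ₂ ≠ ⊥ → ¬ (∀ a b : σ, ψ₁ a = ψ₁ b) →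
      ¬ (∀ a b : σ, ψ₂ a = ψ₂ b) →
      ¬ (∀ a b : σ, a ≤ p → ¬ b ≤ p → (ψ₁ + ψ₂) a = (ψ₁ + ψ₂) b + (K : ℤ)) := by
    intro ψ₁ ψ₂ h1 h2 hnc1 hnc2 hk12
    -- the sum is two-block (jump with both blocks nonempty), hence so are the summands
    have hhi : ∃ b₀ : σ, ¬ b₀ ≤ p := exists_not_le_of_isTwoBlock_of_not_isConstant p h2₀ hnc₀
    have hP12 := isTwoBlock_of_jump p hk12 ⟨p, le_rfl⟩ hhi
    have key := isBlockConstant_face f n (fun a : σ => decide (a ≤ p)) ψ₁ ψ₂ h1 h2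
    simp only [decide_eq_decide] at key
    obtain ⟨hP1, hP2⟩ := key hP12
    obtain ⟨k₁, hk₁⟩ := exists_jump_of_isTwoBlock p hP1
    obtain ⟨k₂, hk₂⟩ := exists_jump_of_isTwoBlock p hP2
    have hK1 := hKmin ψ₁ h1 hP1 hnc1 k₁ hk₁
    have hK2 := hKmin ψ₂ h2 hP2 hnc2 k₂ hk₂
    have hsum := jump_add p hk₁ hk₂
    have hkk : k₁ + k₂ = (K : ℤ) := jump_unique p hsum hk12 ⟨p, le_rfl⟩ hhi
    omega
  obtain ⟨χ, hχ, hP, hk, hnc, hmin, hatom⟩ :=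
    exists_atom_of_indecomposableJump f n p (K : ℤ) ⟨χ₀, hχ₀, h2₀, hk₀, hnc₀⟩ hind
  exact ⟨(K : ℤ), hKpos, hKmin, χ, hχ, hP, hk, hnc, hmin, hatom⟩

end Atoms

/-! ### 3. The permanent: `stub_atomLate` from a late first fattening of the minimal jump -/

variable {m : ℕ}

/-- **Late first fattening of the minimal jump ⇒ late atoms.** Suppose that for every `c, m₀`
some `m ≥ max(m₀, 1)` has a cut `p : MatIdx m` such that (i) some non-constant weight occurring
in `ℂ[Δ_m[per_m]]` is constant on `{a ≤ p}` and on `{a > p}` (the two-block face at `p` is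
populated), and (ii) every occurring non-constant two-block weight at `p` whose jump is MINIMAL
(no occurring non-constant two-block weight at `p` has a smaller jump) has degree
`-|χ|/m > 2^((log₂ m + c)^c)`. Then the registered `stub_atomLate` holds verbatim: the first
fattening of the minimal jump is an atom (`exists_atom_minJump`) and is late by (ii). Sharper
than `…FaceLayers.stub_atomLate_of_late_fatLayer` (only minimal-jump weights need be late); by
the orbit-restriction dictionary of the module docstring the minimal jump at the cut with
`j = #{a ≤ p}` is `k_j(m) ≤ 2m²`, so (ii) asks precisely for a super-quasi-polynomial FIRST
FATTENING `t_j(m)` for infinitely many `m`. [folklore] -/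
theorem stub_atomLate_of_late_minJump
    (H : ∀ c m₀ : ℕ, ∃ m : ℕ, m₀ ≤ m ∧ 1 ≤ m ∧ ∃ p : MatIdx m,
      (∃ χ : Weight (MatIdx m),
        highestWeightSpace (orbitCoordRep (MvPolynomial.rename toLex (perPoly (Fin m) ℂ)) m) χ ≠ ⊥ ∧
        (∀ a b : MatIdx m, (a ≤ p ↔ b ≤ p) → χ a = χ b) ∧ ¬ (∀ a b : MatIdx m, χ a = χ b)) ∧
      (∀ χ : Weight (MatIdx m), ∀ k : ℤ,
        highestWeightSpace (orbitCoordRep (MvPolynomial.rename toLex (perPoly (Fin m) ℂ)) m) χ ≠ ⊥ →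
        (∀ a b : MatIdx m, (a ≤ p ↔ b ≤ p) → χ a = χ b) →
        (∀ a b : MatIdx m, a ≤ p → ¬ b ≤ p → χ a = χ b + k) → ¬ (∀ a b : MatIdx m, χ a = χ b) →
        (∀ ψ : Weight (MatIdx m),
          highestWeightSpace (orbitCoordRep (MvPolynomial.rename toLex (perPoly (Fin m) ℂ)) m) ψ ≠ ⊥ →
          (∀ a b : MatIdx m, (a ≤ p ↔ b ≤ p) → ψ a = ψ b) → ¬ (∀ a b : MatIdx m, ψ a = ψ b) →
          ∀ k' : ℤ, (∀ a b : MatIdx m, a ≤ p → ¬ b ≤ p → ψ a = ψ b + k') → k ≤ k') →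
          (m : ℤ) * 2 ^ ((Nat.log 2 m + c) ^ c) < -(Weight.size χ))) :
    ∀ c m₀ : ℕ, ∃ m : ℕ, m₀ ≤ m ∧ 1 ≤ m ∧ ∃ χ : Weight (MatIdx m),
      highestWeightSpace (orbitCoordRep (MvPolynomial.rename toLex (perPoly (Fin m) ℂ)) m) χ ≠ ⊥ ∧
      (∀ χ₁ χ₂ : Weight (MatIdx m), χ₁ + χ₂ = χ → χ₁ ≠ 0 → χ₂ ≠ 0 →
          highestWeightSpace (orbitCoordRep (MvPolynomial.rename toLex (perPoly (Fin m) ℂ)) m) χ₁ = ⊥ ∨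
            highestWeightSpace (orbitCoordRep (MvPolynomial.rename toLex (perPoly (Fin m) ℂ)) m) χ₂ = ⊥) ∧
      (m : ℤ) * 2 ^ ((Nat.log 2 m + c) ^ c) < -(Weight.size χ) := by
  intro c m₀
  obtain ⟨m, hm₀, hm, p, hex, hlate⟩ := H c m₀
  obtain ⟨k, -, hkmin, χ, hχ, hP, hk, hnc, -, hatom⟩ :=
    exists_atom_minJump (rename toLex (perPoly (Fin m) ℂ)) m p hex
  exact ⟨m, hm₀, hm, χ, hχ, hatom, hlate χ k hχ hP hk hnc hkmin⟩

end Summit.ValiantsHypothesis.ValiantsHypothesis.Theorems.GeneratorObstructions.PerGenDegreeSuperQP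

end
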